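import Summits.QuantumFields.BalabanUV.T4Continuum.Support.UrsellTermBudgetLevels
import Summits.QuantumFields.BalabanUV.T4Continuum.Support.UrsellTermDecay
import Summits.QuantumFields.BalabanUV.T4Continuum.Support.B13StepOfRecord

/-!
# NE5 ∕ U3 — the [26]-CONVERGENCE binder and the (2.27)-DECAY EXTRACTION of node U3 ON BAŁABAN's CARRIERS OF RECORD: leaf-08's
# ordered-Ursell-series budget (`UrsellTermBudget`∕`UrsellTermBudgetLevels`∕`UrsellTermDecay`) fired on the model of record
# `B13StepOfRecord.step`, with ALL THREE polymer-geometry side conditions DISCHARGED by P2's theorems on Bałaban's domains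
# (`B13DomainGeometryTR.loc_b13`, `reach_b13` (ν = 9), `ineq227_level` (c = 5))

Cell `pub-balaban`, unit `b2b-balaban-t4-ne5-formalise-leaf-01` (NE5 formalisation swarm, LEAF PROVER 01, gen 3; free seat on idle
duty — journal INTENT `B13StepOfRecordActNorm`).  Summits-side NEW WORK under the LEAN PLACEMENT RULE (cell bookkeeping; NOT a
Literature module).  HONEST FRAMING: rung (B)+1 of the FINITE-VOLUME T⁴ continuum programme — NOT infinite volume, NOT a mass gap,
NOT the Clay problem, NOT a proof of NE5 (NE5 is NOT PRINTED in [Balaban1987RG1]–[Balaban1989LargeFieldII]; they print ε-UNIFORM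
bounds, never η-RATES).  HONEST DEPENDENCY (cell line, verbatim): continuum YM on T⁴ ⇐ BetaPertH ∧ nine spine estimates (0/9 proved);
BetaPertH ⇐ (D1) ∧ (D4) ∧ CAP+tail; G-an2-4 gates asym, D1 and NE2/3/4.

WHAT THIS FILE DOES (two instantiations BY NAME, no definition, no estimate of the manuscripts under audit).  Row O1-d3 of the
skeleton (`TermRep` ∕ the per-domain `ClassBound` of the (2.13)-series output) displays, after leaf-04's `B13TermRep` ∕
`B13ActMajorantLevels` and leaf-08's `UrsellTermBudget` ∕ `UrsellTermBudgetLevels` (p208307 ∕ p208829 ∕ p209547 ∕ p209760):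
(i) an ACTIVITY-TERM MAJORANT `A k g U Z ℓ` at the class points — the SHAPE of [Balaban1988RG2Cluster] Lemma 3 (2.38) p. 20, kept
DISPLAYED (c3: asserted nowhere); (ii) its ANCHORED EXPONENTIAL NORM `Φ` on every step catalogue with `4νΦ < 1` (for the rate: the
norm `Φ′` of a STRIPPED majorant `A′` with `A ≤ A′·e^{−κ(d(Z)+c)}`); and three polymer-geometry side conditions — (iii) FOOTPRINT
LOCALITY of the touching hard core (`hloc`), (iv) the REACH BOUND `#reach ≤ ν·#cubes` (`hreach`), (v) the (2.27)-SHAPE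
`Ineq227 (level k) cubes d (cubes X) (d X) c` (`h227`).  On the MODEL OF RECORD `B13StepOfRecord.step S E₀ cB` (leaf-09, p208933)
over Bałaban's paired torus carriers `B13Carriers.TwoRuns.carriers` with the geometry OF RECORD `B13DomainGeometryTR.domainGeometry R`,
(iii), (iv) and (v) are THEOREMS of the tree (route P2's `B13DomainGeometryTR.loc_b13`, `reach_b13` with ν = 9, `ineq227_level` with
c = 5 — transported from `TreeLengthTorusGeometry.tgeometry 4 N`), and the output is leaf-08's `out` by `rfl` (`B13StepOfRecord.step_Out`).
Hence:
* `termRep_step_of_actNorm` — `TermRep (B13StepOfRecord.step S E₀ cB) K (term …) W` from (i) + (ii) with `36·Φ < 1` ALONE;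
* `classBound_step_of_actNorm` — `ClassBound (B13StepOfRecord.step S E₀ cB) K W 0 (Φ/(1 − 36Φ))` from the same data (rate 0);
* `actBudget_record_of_actNormDecay` — the per-domain budget WITH RATE on the SOCKET OF RECORD (no step model): `Summable
  (actMajorant …) ∧ ∑' ≤ (Φ′/(1 − 36Φ′))·e^{−κ d(X)}` — VERBATIM the `hbud`∕`hconv` binders of leaf-04's `classBound_b13_of_actBound`
  and of leaf-03's O2-hist faces `histFibreEnvelopeCl_b13_of_actBound` ∕ `histSecant_b13_of_act`, for the socket of record;
* `classBound_step_of_actNormDecay` — `ClassBound (B13StepOfRecord.step S E₀ cB) K W κ (Φ′/(1 − 36Φ′))` WITH THE DECAY RATE `κ ≥ 0`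
  of (2.40)–(2.41) p. 21 (mechanism only, leaf-08's `UrsellTermDecay.classBound_b13_of_actNormDecay`), from (i), the factorwise split
  `A ≤ A′·e^{−κ(d(Z)+5)}` and the anchored norm `Φ′` of `A′` with `36Φ′ < 1` — (2.27) on Bałaban's domains being P2's THEOREM
  `ineq227_level`.
So on Bałaban's carriers of record the [26]-convergence binder of node U3 (p. 20: *"sufficient conditions for convergence of the
series (2.12), (2.13) are satisfied, see [26, 67, 25, 50]"* — locator only) and the per-domain class bound WITH RATE ((2.41)-SHAPE)
now read: a (2.38)-KIND activity-term majorant, its decay split and anchored norm, and `36Φ′ < 1` — nothing geometric left displayed.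
CURRENCIES (no fork): this file is the ANCHORED-NORM currency (the binder `hΦ` = the anchored exponential norm itself, displayed);
leaf-08's `UrsellOfRecord` (p210518, with `UrsellActivityNorm` p210250) is the (2.38)-SHAPE currency on the same model of record
(`classBound_stepOfRecord` ∕ `termRep_stepOfRecord`: the norm COMPUTED from a pointwise `actSum ≤ ε·e^{−R d(Z)}` via (1.26)∕(2.30) —
`ineq126_level` ∕ `volBound_level`); both cite the same TR theorems; journal l.7173 ∕ l.7313 ∕ l.7450.
This instantiates NO analytic leaf on [II]'s kernels ∕ potentials ∕ terms (the `Slots` stay PARAMETERS; the majorant `A` and its norm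
are the business of rows NE2∕NE3 or of a Literature citation, not of this crew); it re-wires NO END face (CLAIM RULE 3: landed results
applied BY NAME in a new Support module).  0 sorry; axioms ⊆ {propext, Classical.choice, Quot.sound}.
-/

noncomputable section

open scoped BigOperators

namespace Summit.QuantumFields.BalabanUV.T4Continuum.B13StepOfRecordActNorm

open Literature.MathematicalPhysics.QuantumFieldTheory.Balaban1983to89
open Literature.MathematicalPhysics.QuantumFieldTheory.Balaban1983to89.T4InputCauchyRateSpecies (ClassBound)
open Literature.MathematicalPhysics.QuantumFieldTheory.Balaban1983to89.T4InputCauchyRateTermwise (TermRep)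
open Summit.QuantumFields.BalabanUV.T4Continuum.B13Carriers (TwoRuns)
open Summit.QuantumFields.BalabanUV.T4Continuum.B13OpDatum (OpDatum)
open Summit.QuantumFields.BalabanUV.T4Continuum.B13StepTermLabels (TermIdx InnerLabel)
open Summit.QuantumFields.BalabanUV.T4Continuum.B13StepTermFamily (term)
open Summit.QuantumFields.BalabanUV.T4Continuum.B13StepTermSocket (labelsIndexing touchInc)
open Summit.QuantumFields.BalabanUV.T4Continuum.B13InnerData (Bnd b13InnerData)
open Summit.QuantumFields.BalabanUV.T4Continuum.B13ActMajorantLevels (polyWeight)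
open Summit.QuantumFields.BalabanUV.T4Continuum.UrsellTreeSum (ind)
open Summit.QuantumFields.BalabanUV.T4Continuum.B13TermRep (actMajorant classBound_b13_of_actBound)
open Summit.QuantumFields.BalabanUV.T4Continuum.UrsellTermBudget (actSum summable_actMajorant tsum_actMajorant_le
  termRep_socket_of_actNorm classBound_socket_of_actNorm)
open Summit.QuantumFields.BalabanUV.T4Continuum.UrsellTermDecay (summable_actMajorant_of_decay tsum_actMajorant_le_of_decay
  d_le_sum_polys_of_ineq227 classBound_b13_of_actNormDecay)
open Summit.QuantumFields.BalabanUV.T4Continuum.B13DomainGeometryTR (SCube footprint reach loc_b13 reach_b13 ineq227_level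
  domainGeometry)

variable {G : Type} [GaugeGroup G] {R : TwoRuns G} {E IOp Hist : Type*} [NormedAddCommGroup Hist] [NormedSpace ℂ Hist]
  (S : B13StepOfRecord.Slots R E IOp Hist) (E₀ cB : ℝ)

/-- [folklore] **`TermRep` ON THE MODEL OF RECORD FROM THE ACTIVITY MAJORANT AND ITS ANCHORED NORM ALONE.**  For the assembled step
model on Bałaban's carriers of record (`B13StepOfRecord.step S E₀ cB`), a nonnegative activity-term majorant `A k g U` of the
(2.14)-terms `S.act` at the class points `K k g U` (binder (i): the SHAPE of [Balaban1988RG2Cluster] Lemma 3 (2.38) p. 20 —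
displayed, locator only) whose ANCHORED EXPONENTIAL NORM over every step catalogue `R.domAt k` is at most `Φ` with `36·Φ < 1` GIVES
the termwise representation `TermRep`; the footprint locality and the reach bound (ν = 9) of leaf-08's budget are DISCHARGED by
`B13DomainGeometryTR.loc_b13` ∕ `reach_b13`, the output identity by `B13StepOfRecord.step_Out` (`rfl`). -/
theorem termRep_step_of_actNorm {K : ℕ → (ℕ → ℝ) → R.carriers.BgB → Set (OpDatum E × Hist)} {W : Set (ℕ → ℝ)}
    {A : ℕ → (ℕ → ℝ) → R.carriers.BgB → R.carriers.Dom → InnerLabel R.carriers.Dom (Bnd R) → ℝ}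
    (hA0 : ∀ k g U Z ℓ, 0 ≤ A k g U Z ℓ)
    (hA : ∀ k, ∀ g ∈ W, ∀ (U : R.carriers.BgB) (q : OpDatum E × Hist), q ∈ K k g U → ∀ X : R.carriers.Dom,
      R.carriers.scale X = k → ∀ i : TermIdx R.carriers.Dom (Bnd R),
        (labelsIndexing (domainGeometry R) (b13InnerData R)).Rel k i X →
        ∀ m, ‖S.act ((labelsIndexing (domainGeometry R) (b13InnerData R)).poly i m)
              ((labelsIndexing (domainGeometry R) (b13InnerData R)).lab i m) q.1 q.2‖ ≤
          A k g U ((labelsIndexing (domainGeometry R) (b13InnerData R)).poly i m)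
            ((labelsIndexing (domainGeometry R) (b13InnerData R)).lab i m))
    {Φ : ℝ} (hΦ0 : 0 ≤ Φ) (hsmall : 36 * Φ < 1)
    (hΦ : ∀ k, ∀ g ∈ W, ∀ (U : R.carriers.BgB) (q : SCube R),
      ∑ Z ∈ R.domAt k, ind (q ∈ footprint Z) * polyWeight (b13InnerData R) (A k g U) k Z *
        Real.exp ((footprint Z).card) ≤ Φ) :
    TermRep (B13StepOfRecord.step S E₀ cB) K
      (term (labelsIndexing (domainGeometry R) (b13InnerData R)) (touchInc (domainGeometry R)) S.act) W :=
  termRep_socket_of_actNorm (domainGeometry R) (b13InnerData R) S.act (M := B13StepOfRecord.step S E₀ cB)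
    (fun _ _ _ _ => rfl) hA0 hA reach (fun Z Z' h => loc_b13 Z Z' h) (by norm_num) reach_b13 hΦ0
    (by linarith) hΦ

/-- [folklore] **The per-domain `ClassBound` ON THE MODEL OF RECORD, decay rate 0, class constant `Φ/(1 − 36Φ)`** from the same
data — leaf-08's levelwise budget (`UrsellTermBudgetLevels.classBound_socket_of_actNorm`) with the footprint locality and the reach
bound DISCHARGED on Bałaban's domains.  (The rate `κ > 0` of (2.41) p. 21 needs the displayed geometric step (2.27)∕(2.40) — not
extracted here.) -/
theorem classBound_step_of_actNorm {K : ℕ → (ℕ → ℝ) → R.carriers.BgB → Set (OpDatum E × Hist)} {W : Set (ℕ → ℝ)}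
    {A : ℕ → (ℕ → ℝ) → R.carriers.BgB → R.carriers.Dom → InnerLabel R.carriers.Dom (Bnd R) → ℝ}
    (hA0 : ∀ k g U Z ℓ, 0 ≤ A k g U Z ℓ)
    (hA : ∀ k, ∀ g ∈ W, ∀ (U : R.carriers.BgB) (q : OpDatum E × Hist), q ∈ K k g U → ∀ X : R.carriers.Dom,
      R.carriers.scale X = k → ∀ i : TermIdx R.carriers.Dom (Bnd R),
        (labelsIndexing (domainGeometry R) (b13InnerData R)).Rel k i X →
        ∀ m, ‖S.act ((labelsIndexing (domainGeometry R) (b13InnerData R)).poly i m)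
              ((labelsIndexing (domainGeometry R) (b13InnerData R)).lab i m) q.1 q.2‖ ≤
          A k g U ((labelsIndexing (domainGeometry R) (b13InnerData R)).poly i m)
            ((labelsIndexing (domainGeometry R) (b13InnerData R)).lab i m))
    {Φ : ℝ} (hΦ0 : 0 ≤ Φ) (hsmall : 36 * Φ < 1)
    (hΦ : ∀ k, ∀ g ∈ W, ∀ (U : R.carriers.BgB) (q : SCube R),
      ∑ Z ∈ R.domAt k, ind (q ∈ footprint Z) * polyWeight (b13InnerData R) (A k g U) k Z *
        Real.exp ((footprint Z).card) ≤ Φ) :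
    ClassBound (B13StepOfRecord.step S E₀ cB) K W 0 (Φ / (1 - 36 * Φ)) := by
  have h := classBound_socket_of_actNorm (domainGeometry R) (b13InnerData R) S.act (M := B13StepOfRecord.step S E₀ cB)
    (K := K) (W := W) (𝒜 := A) (fun _ _ _ _ => rfl) hA0 hA reach (fun Z Z' h => loc_b13 Z Z' h) (by norm_num) reach_b13
    hΦ0 (by linarith) hΦ
  have h36 : (4 : ℝ) * 9 * Φ = 36 * Φ := by ring
  rwa [h36] at h

/-- [folklore] **THE PER-DOMAIN BUDGET WITH RATE ON THE SOCKET OF RECORD** (no step model involved): for a nonnegative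
activity-term majorant `A` that splits factorwise against a STRIPPED majorant, `A ≤ A′·e^{−κ(d(Z)+5)}` (κ ≥ 0), whose anchored
exponential norm on every `R.domAt k` is `≤ Φ′` with `36Φ′ < 1`, the combinatorial majorant of row O1-d3 on the term indexing ∕
hard core OF RECORD is summable at every step-`k` domain with `∑' ≤ (Φ′/(1 − 36Φ′))·e^{−κ d(X)}` — leaf-08's `UrsellTermBudget.
summable_actMajorant`∕`tsum_actMajorant_le` (on `A′`) and `UrsellTermDecay.summable_actMajorant_of_decay`∕`tsum_actMajorant_le_of_decay`
with footprint locality, reach (ν = 9) AND (2.27) (c = 5) DISCHARGED by `B13DomainGeometryTR.loc_b13`∕`reach_b13`∕`ineq227_level`.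
This is VERBATIM the `hbud` binder of leaf-04's `B13TermRep.classBound_b13_of_actBound` and of leaf-03's
`B13TermHistEnvelope.histFibreEnvelopeCl_b13_of_actBound`, and its first component the `hconv` binder of
`B13TermHistSecant.histSecant_b13_of_act` — for the socket of record. -/
theorem actBudget_record_of_actNormDecay {W : Set (ℕ → ℝ)}
    {A A' : ℕ → (ℕ → ℝ) → R.carriers.BgB → R.carriers.Dom → InnerLabel R.carriers.Dom (Bnd R) → ℝ} {κ : ℝ} (hκ : 0 ≤ κ)
    (hA0 : ∀ k g U Z ℓ, 0 ≤ A k g U Z ℓ) (hA0' : ∀ k g U Z ℓ, 0 ≤ A' k g U Z ℓ)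
    (hdec : ∀ k g U Z ℓ, A k g U Z ℓ ≤ A' k g U Z ℓ * Real.exp (-(κ * (R.carriers.d Z + 5))))
    {Φ' : ℝ} (hΦ0 : 0 ≤ Φ') (hsmall : 36 * Φ' < 1)
    (hΦ : ∀ k, ∀ g ∈ W, ∀ (U : R.carriers.BgB) (q : SCube R),
      ∑ Z ∈ R.domAt k, ind (q ∈ footprint Z) * actSum (b13InnerData R) (A' k g U) k Z *
        Real.exp ((footprint Z).card) ≤ Φ') :
    ∀ k, ∀ g ∈ W, ∀ (U : R.carriers.BgB) (X : R.carriers.Dom), R.carriers.scale X = k →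
      Summable (actMajorant (labelsIndexing (domainGeometry R) (b13InnerData R)) (touchInc (domainGeometry R)) (A k g U) k X) ∧
        ∑' i, actMajorant (labelsIndexing (domainGeometry R) (b13InnerData R)) (touchInc (domainGeometry R)) (A k g U) k X i ≤
          Φ' / (1 - 36 * Φ') * Real.exp (-(κ * R.carriers.d X)) := by
  intro k g hg U X hX
  have hsmall' : 4 * 9 * Φ' < 1 := by linarith
  have hgeo : ∀ i : TermIdx R.carriers.Dom (Bnd R), (labelsIndexing (domainGeometry R) (b13InnerData R)).Rel k i X →
      R.carriers.d X ≤ ∑ m, (R.carriers.d ((labelsIndexing (domainGeometry R) (b13InnerData R)).poly i m) + 5) :=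
    fun i hi => d_le_sum_polys_of_ineq227 (domainGeometry R) (b13InnerData R) (by norm_num) (hX ▸ ineq227_level X) i hi
  have hs' := summable_actMajorant (domainGeometry R) (b13InnerData R) (A' k g U) reach (hA0' k g U)
    (fun Z Z' h => loc_b13 Z Z' h) (by norm_num) reach_b13 hΦ0 hsmall' (hΦ k g hg U) X
  have ht' := tsum_actMajorant_le (domainGeometry R) (b13InnerData R) (A' k g U) reach (hA0' k g U)
    (fun Z Z' h => loc_b13 Z Z' h) (by norm_num) reach_b13 hΦ0 hsmall' (hΦ k g hg U) X
  have h36 : (4 : ℝ) * 9 * Φ' = 36 * Φ' := by ring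
  rw [h36] at ht'
  exact ⟨summable_actMajorant_of_decay (hA0 k g U) (hA0' k g U) hκ (hdec k g U) hgeo hs',
    tsum_actMajorant_le_of_decay (hA0 k g U) (hA0' k g U) hκ (hdec k g U) hgeo hs' ht'⟩

/-- [folklore] **The per-domain `ClassBound` ON THE MODEL OF RECORD WITH THE DECAY RATE** ((2.40)–(2.41) p. 21 mechanism, leaf-08's
`UrsellTermDecay.classBound_b13_of_actNormDecay`, fired on Bałaban's carriers of record): from (i) a nonnegative activity-term
majorant `A k g U` of `S.act` at the class points ((2.38)-KIND, displayed), (ii) its factorwise split against a STRIPPED majorant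
`A ≤ A′·e^{−κ(d(Z)+5)}` (κ ≥ 0), and (iii) the anchored exponential norm `Φ′` of `A′` on every `R.domAt k` with `36Φ′ < 1`, conclude
`ClassBound (B13StepOfRecord.step S E₀ cB) K W κ (Φ′/(1 − 36Φ′))`.  ALL THREE geometry binders of leaf-08's theorem are DISCHARGED
by P2's theorems on Bałaban's domains: footprint locality `loc_b13`, reach `reach_b13` (ν = 9), and (2.27) `ineq227_level` (c = 5). -/
theorem classBound_step_of_actNormDecay {K : ℕ → (ℕ → ℝ) → R.carriers.BgB → Set (OpDatum E × Hist)} {W : Set (ℕ → ℝ)}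
    {A A' : ℕ → (ℕ → ℝ) → R.carriers.BgB → R.carriers.Dom → InnerLabel R.carriers.Dom (Bnd R) → ℝ} {κ : ℝ} (hκ : 0 ≤ κ)
    (hA : ∀ k, ∀ g ∈ W, ∀ (U : R.carriers.BgB) (q : OpDatum E × Hist), q ∈ K k g U → ∀ X : R.carriers.Dom,
      R.carriers.scale X = k → ∀ i : TermIdx R.carriers.Dom (Bnd R),
        (labelsIndexing (domainGeometry R) (b13InnerData R)).Rel k i X →
        ∀ m, ‖S.act ((labelsIndexing (domainGeometry R) (b13InnerData R)).poly i m)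
              ((labelsIndexing (domainGeometry R) (b13InnerData R)).lab i m) q.1 q.2‖ ≤
          A k g U ((labelsIndexing (domainGeometry R) (b13InnerData R)).poly i m)
            ((labelsIndexing (domainGeometry R) (b13InnerData R)).lab i m))
    (hA0 : ∀ k g U Z ℓ, 0 ≤ A k g U Z ℓ) (hA0' : ∀ k g U Z ℓ, 0 ≤ A' k g U Z ℓ)
    (hdec : ∀ k g U Z ℓ, A k g U Z ℓ ≤ A' k g U Z ℓ * Real.exp (-(κ * (R.carriers.d Z + 5))))
    {Φ' : ℝ} (hΦ0 : 0 ≤ Φ') (hsmall : 36 * Φ' < 1)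
    (hΦ : ∀ k, ∀ g ∈ W, ∀ (U : R.carriers.BgB) (q : SCube R),
      ∑ Z ∈ R.domAt k, ind (q ∈ footprint Z) * actSum (b13InnerData R) (A' k g U) k Z *
        Real.exp ((footprint Z).card) ≤ Φ') :
    ClassBound (B13StepOfRecord.step S E₀ cB) K W κ (Φ' / (1 - 36 * Φ')) :=
  classBound_b13_of_actBound (M := B13StepOfRecord.step S E₀ cB) (fun _ _ _ _ => rfl) hA
    (actBudget_record_of_actNormDecay hκ hA0 hA0' hdec hΦ0 hsmall hΦ)

/-- [folklore] Consistency: the same class bound through leaf-08's bundled END point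
`UrsellTermDecay.classBound_b13_of_actNormDecay` (ν = 9 written as `4·9`). -/
example {K : ℕ → (ℕ → ℝ) → R.carriers.BgB → Set (OpDatum E × Hist)} {W : Set (ℕ → ℝ)}
    {A A' : ℕ → (ℕ → ℝ) → R.carriers.BgB → R.carriers.Dom → InnerLabel R.carriers.Dom (Bnd R) → ℝ} {κ : ℝ} (hκ : 0 ≤ κ)
    (hA : ∀ k, ∀ g ∈ W, ∀ (U : R.carriers.BgB) (q : OpDatum E × Hist), q ∈ K k g U → ∀ X : R.carriers.Dom,
      R.carriers.scale X = k → ∀ i : TermIdx R.carriers.Dom (Bnd R),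
        (labelsIndexing (domainGeometry R) (b13InnerData R)).Rel k i X →
        ∀ m, ‖S.act ((labelsIndexing (domainGeometry R) (b13InnerData R)).poly i m)
              ((labelsIndexing (domainGeometry R) (b13InnerData R)).lab i m) q.1 q.2‖ ≤
          A k g U ((labelsIndexing (domainGeometry R) (b13InnerData R)).poly i m)
            ((labelsIndexing (domainGeometry R) (b13InnerData R)).lab i m))
    (hA0 : ∀ k g U Z ℓ, 0 ≤ A k g U Z ℓ) (hA0' : ∀ k g U Z ℓ, 0 ≤ A' k g U Z ℓ)
    (hdec : ∀ k g U Z ℓ, A k g U Z ℓ ≤ A' k g U Z ℓ * Real.exp (-(κ * (R.carriers.d Z + 5))))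
    {Φ' : ℝ} (hΦ0 : 0 ≤ Φ') (hsmall : 4 * 9 * Φ' < 1)
    (hΦ : ∀ k, ∀ g ∈ W, ∀ (U : R.carriers.BgB) (q : SCube R),
      ∑ Z ∈ R.domAt k, ind (q ∈ footprint Z) * actSum (b13InnerData R) (A' k g U) k Z *
        Real.exp ((footprint Z).card) ≤ Φ') :
    ClassBound (B13StepOfRecord.step S E₀ cB) K W κ (Φ' / (1 - 4 * 9 * Φ')) :=
  classBound_b13_of_actNormDecay (domainGeometry R) (b13InnerData R) S.act (M := B13StepOfRecord.step S E₀ cB)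
    (fun _ _ _ _ => rfl) hκ (by norm_num : (0 : ℝ) ≤ 5) hA hA0 hA0' hdec (fun X => ineq227_level X) reach
    (fun Z Z' h => loc_b13 Z Z' h) (by norm_num) reach_b13 hΦ0 hsmall hΦ

/-- [folklore] **BOTH AT ONCE** (the census line): on Bałaban's carriers of record, a (2.38)-KIND activity-term majorant with
anchored exponential norm `Φ`, `36Φ < 1`, gives the termwise representation AND the per-domain class bound `Φ/(1 − 36Φ)` (rate 0)
of the model of record — the [26]-convergence binder of node U3 with its geometry inputs discharged by theorems. -/
theorem termRep_and_classBound_step_of_actNorm {K : ℕ → (ℕ → ℝ) → R.carriers.BgB → Set (OpDatum E × Hist)} {W : Set (ℕ → ℝ)}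
    {A : ℕ → (ℕ → ℝ) → R.carriers.BgB → R.carriers.Dom → InnerLabel R.carriers.Dom (Bnd R) → ℝ}
    (hA0 : ∀ k g U Z ℓ, 0 ≤ A k g U Z ℓ)
    (hA : ∀ k, ∀ g ∈ W, ∀ (U : R.carriers.BgB) (q : OpDatum E × Hist), q ∈ K k g U → ∀ X : R.carriers.Dom,
      R.carriers.scale X = k → ∀ i : TermIdx R.carriers.Dom (Bnd R),
        (labelsIndexing (domainGeometry R) (b13InnerData R)).Rel k i X →
        ∀ m, ‖S.act ((labelsIndexing (domainGeometry R) (b13InnerData R)).poly i m)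
              ((labelsIndexing (domainGeometry R) (b13InnerData R)).lab i m) q.1 q.2‖ ≤
          A k g U ((labelsIndexing (domainGeometry R) (b13InnerData R)).poly i m)
            ((labelsIndexing (domainGeometry R) (b13InnerData R)).lab i m))
    {Φ : ℝ} (hΦ0 : 0 ≤ Φ) (hsmall : 36 * Φ < 1)
    (hΦ : ∀ k, ∀ g ∈ W, ∀ (U : R.carriers.BgB) (q : SCube R),
      ∑ Z ∈ R.domAt k, ind (q ∈ footprint Z) * polyWeight (b13InnerData R) (A k g U) k Z *
        Real.exp ((footprint Z).card) ≤ Φ) :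
    TermRep (B13StepOfRecord.step S E₀ cB) K
        (term (labelsIndexing (domainGeometry R) (b13InnerData R)) (touchInc (domainGeometry R)) S.act) W ∧
      ClassBound (B13StepOfRecord.step S E₀ cB) K W 0 (Φ / (1 - 36 * Φ)) :=
  ⟨termRep_step_of_actNorm S E₀ cB hA0 hA hΦ0 hsmall hΦ, classBound_step_of_actNorm S E₀ cB hA0 hA hΦ0 hsmall hΦ⟩

end Summit.QuantumFields.BalabanUV.T4Continuum.B13StepOfRecordActNorm

end
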